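import Mathlib
import HarnessLib
import Summits.Ventures.LatticeQCDFlow.Exactness.SUNResidualJacobiTrace

/-!
# The trace identity `tr(Top⁻¹ Ṫop) = −div_a Z` for the `SU(N)` residual layer at a fixed configuration

HONEST FRAMING: exact (Metropolis-corrected) sampling algorithms for lattice gauge theory;
figures of merit are autocorrelation/cost numbers at stated couplings and volumes; no
continuum-physics claim.

Venture `LatticeQCDFlow` (cell pub-lqcd), topic `Exactness`; FANOUT row 10 (`eng-equiv`: `equiv/residual.py`,
`flows_jax/residual_flow.py` — residual / stout / stout-defect layers and their closed-form per-link log-det).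
NEW WORK of the cell; no definition (local notations only); nothing cited as a fact.  Series "the residual
layer's exact Jacobian IS the closed form" (8 files: `SUNJacobianTraceAlgebra`, `SUNResidualTangentDerivative`,
`SUNResidualTangentTimeDerivative`, `SUNResidualGeneratorDivergence`, `SUNResidualJacobiTrace`,
`SUNResidualJacobiIdentity`, `SUNResidualJacobiFlow`, `SUNResidualLayerJacobianDet`), continuing gen-11's
`SUNResidualLayerVelocity` … `SUNResidualLayerJacobian` (existence of a continuous positive exact Jacobian).

File 6 of the series (local notations as before).  The static heart of the identification:
* `commutator_skew`, `suProj_neg'`, `fderiv_residualTangentOp_apply_vec`,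
  `fderiv_residualTangentBlock_eq_fderiv_residualTangentOp`;
* **`jacobi_trace_identity`** — at an `SU(n)^E` configuration, time `s`, active link `a`, generator `Z`, basis `(T^b)`:
  `∑_b (Top⁻¹ 𝒫 (σ′(s)(D Qamb_a·single a (T^b U_a) + [Qamb_a, Blk T^b]) + ∂_{single a (Z_a U_a)}(Blk·T^b)))^b
   = −∑_b (∂_{single a (T^b U_a)} Z_a)^b` — the left side is Jacobi's `tr(Top⁻¹ Ṫop)` along the flow, the right
  side minus the `a`-term of the divergence; by the linearised generator identity, the exchange identity and
  `tr(𝒫 ad 𝒫) = 0` (for `ad_{Qamb_a}`, `ad_{Z_a}`, `ad_{Blk Z_a}`).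

Printed counterparts, NAMED ONLY: Lüscher, CMP 293 (2010) 899, §3 eqs. (3.4)–(3.9); Abbott et al.,
arXiv:2305.02402 §4.2; Morningstar–Peardon, PRD 69 (2004) 054501; Abel–Jacobi–Liouville (tree:
`Literature.Analysis.ODE.LiouvilleFormula`).
-/

noncomputable section

namespace Summit.Ventures.LatticeQCDFlow.Exactness

open Literature.MathematicalPhysics.QuantumFieldTheory
open Literature.MathematicalPhysics.QuantumFieldTheory.Luscher2010
open Literature.MathematicalPhysics.QuantumFieldTheory.WilsonFlow
open Summit.Ventures.LatticeQCDFlow.TrivializingMaps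
open Filter Set
open scoped Matrix Matrix.Norms.Frobenius Topology ContDiff

variable {d L n : ℕ} [NeZero L]

section StaticIdentity

variable (p : Edge d L → Prop) [DecidablePred p]
  (Q : {e : Edge d L // p e} → ({f : Edge d L // ¬p f} → Matrix.specialUnitaryGroup (Fin n) ℂ) →
    Matrix (Fin n) (Fin n) ℂ → Matrix (Fin n) (Fin n) ℂ)
  (κ : {e : Edge d L // p e} → ({f : Edge d L // ¬p f} → Matrix.specialUnitaryGroup (Fin n) ℂ) → ℝ)
  (Qamb : {e : Edge d L // p e} → AmbConfig d L n → Matrix (Fin n) (Fin n) ℂ)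

set_option quotPrecheck false in
/-- The residual isotopy at time `τ` (local notation, as in `SUNResidualIsotopy`). -/
local notation "famb[" τ "]" => (fun (W : AmbConfig d L n) (e : Edge d L) =>
  if h : p e then NormedSpace.exp ((τ : ℝ) • Qamb ⟨e, h⟩ W) * W e else W e)

set_option quotPrecheck false in
/-- The block of the tangential operator (local notation, as in `SUNResidualTangentOperator`). -/
local notation "Blk[" τ ", " W ", " a "]" =>
  ((fderiv ℝ (fun Y : Matrix (Fin n) (Fin n) ℂ => Y * ((famb[τ]) W a)ᴴ) 0).comp
    ((fderiv ℝ (fun W' : AmbConfig d L n => W' a) 0).comp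
      ((fderiv ℝ (famb[τ]) W).comp
        ((fderiv ℝ (fun Y : Matrix (Fin n) (Fin n) ℂ => (Pi.single a Y : AmbConfig d L n)) 0).comp
          (fderiv ℝ (fun Y : Matrix (Fin n) (Fin n) ℂ => Y * W a) 0)))))

set_option quotPrecheck false in
/-- The tangential operator (local notation, as in `SUNResidualTangentOperator`). -/
local notation "Top[" τ ", " W ", " a "]" =>
  ((fderiv ℝ (suProj (n := n)) 0).comp ((Blk[τ, W, a]).comp (fderiv ℝ (suProj (n := n)) 0)) +
    (ContinuousLinearMap.id ℝ (Matrix (Fin n) (Fin n) ℂ) - fderiv ℝ (suProj (n := n)) 0))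

set_option quotPrecheck false in
/-- The time reparametrisation `σ(s) = (1 − cos πs)/2` (local notation). -/
local notation "σ(" s ")" => ((1 - Real.cos (Real.pi * s)) / 2)

set_option quotPrecheck false in
/-- Its derivative `σ′(s) = (π/2) sin πs` (local notation). -/
local notation "σ'(" s ")" => (Real.pi / 2 * Real.sin (Real.pi * s))

/-! ## Small algebra -/

omit [NeZero L] in
/-- The commutator of two elements of `𝔰𝔲(n)` lies in `𝔰𝔲(n)`. -/
theorem commutator_skew {X Y : Matrix (Fin n) (Fin n) ℂ} (hX : Xᴴ = -X) (hY : Yᴴ = -Y) :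
    (X * Y - Y * X)ᴴ = -(X * Y - Y * X) ∧ (X * Y - Y * X).trace = 0 := by
  refine ⟨?_, ?_⟩
  · rw [Matrix.conjTranspose_sub, Matrix.conjTranspose_mul, Matrix.conjTranspose_mul, hX, hY,
      neg_mul_neg, neg_mul_neg, neg_sub]
  · rw [Matrix.trace_sub, Matrix.trace_mul_comm, sub_self]

omit [NeZero L] in
/-- `𝒫 (−X) = −𝒫 X`. -/
theorem suProj_neg' (X : Matrix (Fin n) (Fin n) ℂ) : suProj (-X) = -suProj X := by
  have h := suProj_smul (n := n) (-1 : ℝ) X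
  rwa [neg_one_smul, neg_one_smul] at h

/-- The derivative of `W' ↦ Top[τ, W', a] ζ` through the block: vector form of
`fderiv_residualTangentOpMap_apply`. -/
theorem fderiv_residualTangentOp_apply_vec (hQ2 : ∀ a, ContDiff ℝ 2 (Qamb a)) (τ : ℝ) (a : Edge d L)
    (W₀ h : AmbConfig d L n) (ζ : Matrix (Fin n) (Fin n) ℂ) :
    fderiv ℝ (fun W : AmbConfig d L n => (Top[τ, W, a]) ζ) W₀ h =
      suProj (fderiv ℝ (fun W : AmbConfig d L n => (Blk[τ, W, a]) (suProj ζ)) W₀ h) := by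
  letI i1 : NormedAddCommGroup (Matrix (Fin n) (Fin n) ℂ →L[ℝ] Matrix (Fin n) (Fin n) ℂ) :=
    ContinuousLinearMap.toNormedAddCommGroup
  letI i2 : NormedSpace ℝ (Matrix (Fin n) (Fin n) ℂ →L[ℝ] Matrix (Fin n) (Fin n) ℂ) :=
    ContinuousLinearMap.toNormedSpace
  have h1 : HasFDerivAt (fun W : AmbConfig d L n => (Top[τ, W, a]) ζ)
      ((ContinuousLinearMap.apply ℝ (Matrix (Fin n) (Fin n) ℂ) ζ).comp
        (fderiv ℝ (fun W : AmbConfig d L n => Top[τ, W, a]) W₀)) W₀ :=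
    (ContinuousLinearMap.apply ℝ (Matrix (Fin n) (Fin n) ℂ) ζ).hasFDerivAt.comp W₀
      (hasFDerivAt_residualTangentOpMap_right p Qamb hQ2 τ a W₀)
  have h2 := congrArg (fun T : AmbConfig d L n →L[ℝ] Matrix (Fin n) (Fin n) ℂ => T h) h1.fderiv
  have h3 : fderiv ℝ (fun W : AmbConfig d L n => Top[τ, W, a]) W₀ h ζ =
      suProj (fderiv ℝ (fun W : AmbConfig d L n => (Blk[τ, W, a]) (suProj ζ)) W₀ h) :=
    fderiv_residualTangentOpMap_apply p Qamb hQ2 τ a W₀ h ζ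
  exact h2.trans h3

/-- On tangent directions, the derivatives of `W' ↦ Blk[τ, W', a] Y` and `W' ↦ Top[τ, W', a] Y` agree
(`Y ∈ 𝔰𝔲(n)`; both functions coincide along curves in `SU(n)^E`). -/
theorem fderiv_residualTangentBlock_eq_fderiv_residualTangentOp (hQ2 : ∀ a, ContDiff ℝ 2 (Qamb a))
    (hQ : ∀ a y, ∀ U ∈ Matrix.specialUnitaryGroup (Fin n) ℂ, (Q a y U)ᴴ = -Q a y U ∧ (Q a y U).trace = 0)
    (hlip : ∀ a y, ∀ U ∈ Matrix.specialUnitaryGroup (Fin n) ℂ, ∀ V ∈ Matrix.specialUnitaryGroup (Fin n) ℂ,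
      frobNorm (Q a y U - Q a y V) ≤ κ a y * frobNorm (U - V))
    (hQambQ : ∀ a (U : GaugeConfig d L (Matrix.specialUnitaryGroup (Fin n) ℂ)),
      Qamb a (coeConfig U) = Q a (fun f => U f) (U a.1 : Matrix (Fin n) (Fin n) ℂ))
    (τ : ℝ) (U : GaugeConfig d L (Matrix.specialUnitaryGroup (Fin n) ℂ)) {a : Edge d L} (ha : p a) (e : Edge d L)
    {X Y : Matrix (Fin n) (Fin n) ℂ} (hX : Xᴴ = -X) (hX0 : X.trace = 0) (hY : Yᴴ = -Y) (hY0 : Y.trace = 0) :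
    fderiv ℝ (fun W' : AmbConfig d L n => (Blk[τ, W', a]) Y) (coeConfig U)
        (Pi.single e (X * (U e : Matrix (Fin n) (Fin n) ℂ))) =
      fderiv ℝ (fun W' : AmbConfig d L n => (Top[τ, W', a]) Y) (coeConfig U)
        (Pi.single e (X * (U e : Matrix (Fin n) (Fin n) ℂ))) := by
  have hγmem : ∀ r : ℝ, NormedSpace.exp (r • X) * (U e : Matrix (Fin n) (Fin n) ℂ) ∈
      Matrix.specialUnitaryGroup (Fin n) ℂ := exp_smul_mul_mem_specialUnitaryGroup (U e).2 hX hX0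
  have h0 : Function.update (coeConfig U) e (NormedSpace.exp ((0 : ℝ) • X) * (U e : Matrix (Fin n) (Fin n) ℂ))
      = coeConfig U := by
    rw [zero_smul, NormedSpace.exp_zero, one_mul]
    exact Function.update_eq_self e (coeConfig U)
  have hcurve := hasDerivAt_update_exp_smul (coeConfig U) e X
  rw [coeConfig_apply] at hcurve
  have hgB : DifferentiableAt ℝ (fun W' : AmbConfig d L n => (Blk[τ, W', a]) Y) (coeConfig U) :=
    ((contDiff_residualTangentBlock_apply_right p Qamb hQ2 τ a Y).differentiable (by norm_num)).differentiableAt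
  have hgT : DifferentiableAt ℝ (fun W' : AmbConfig d L n => (Top[τ, W', a]) Y) (coeConfig U) :=
    ((contDiff_residualTangentOp_apply_right p Qamb hQ2 τ a Y).differentiable (by norm_num)).differentiableAt
  have hB := hgB.hasFDerivAt.comp_hasDerivAt_of_eq (0 : ℝ) hcurve h0.symm
  have hT := hgT.hasFDerivAt.comp_hasDerivAt_of_eq (0 : ℝ) hcurve h0.symm
  have hagree : ∀ r : ℝ, (Top[τ, Function.update (coeConfig U) e
      (NormedSpace.exp (r • X) * (U e : Matrix (Fin n) (Fin n) ℂ)), a]) Y =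
      (Blk[τ, Function.update (coeConfig U) e (NormedSpace.exp (r • X) * (U e : Matrix (Fin n) (Fin n) ℂ)), a]) Y := by
    intro r
    rw [update_coeConfig_eq U e ⟨_, hγmem r⟩]
    exact residualTangentOp_apply_of_skew p Q κ Qamb hQ2 hQ hlip hQambQ τ _ ha hY hY0
  have hT' := hT.congr_of_eventuallyEq (Filter.Eventually.of_forall fun r => (hagree r).symm)
  exact hB.unique hT'

/-! ## The static trace identity behind Jacobi's formula -/

/-- **The trace identity.**  At an `SU(n)^E` configuration `U`, time `s`, active link `a`, for the
generator `Z` of the inverse isotopy and any orthonormal basis `(T^b)` of `𝔰𝔲(n)`: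
`∑_b (Top⁻¹ 𝒫 (σ′(s)(D Qamb_a·single a (T^b U_a) + [Qamb_a, Blk T^b]) + ∂_{single a (Z_a U_a)} (Blk · T^b)))^b
   = −∑_b (∂_{single a (T^b U_a)} Z_a)^b`
— the left side is `tr(Top⁻¹ Ṫop)` along the flow, the right side is minus the `a`-term of `div Z_s`.
Ingredients: the linearised generator identity, the exchange identity (symmetry of second derivatives),
and `tr(𝒫 ad 𝒫) = 0`. -/
theorem jacobi_trace_identity (B : SuBasis n) (hQ2 : ∀ a, ContDiff ℝ 2 (Qamb a))
    (hQ : ∀ a y, ∀ U ∈ Matrix.specialUnitaryGroup (Fin n) ℂ, (Q a y U)ᴴ = -Q a y U ∧ (Q a y U).trace = 0)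
    (hlip : ∀ a y, ∀ U ∈ Matrix.specialUnitaryGroup (Fin n) ℂ, ∀ V ∈ Matrix.specialUnitaryGroup (Fin n) ℂ,
      frobNorm (Q a y U - Q a y V) ≤ κ a y * frobNorm (U - V))
    (hκ0 : ∀ a y, 0 ≤ κ a y) (hκ : ∀ a y, κ a y < 1)
    (hQambQ : ∀ a (U : GaugeConfig d L (Matrix.specialUnitaryGroup (Fin n) ℂ)),
      Qamb a (coeConfig U) = Q a (fun f => U f) (U a.1 : Matrix (Fin n) (Fin n) ℂ))
    {Z : ℝ → AmbConfig d L n → AmbConfig d L n}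
    (hZ1 : ContDiff ℝ 1 (fun q : ℝ × AmbConfig d L n => Z q.1 q.2))
    (hZsu : ∀ (s : ℝ) (U : GaugeConfig d L (Matrix.specialUnitaryGroup (Fin n) ℂ)) (e : Edge d L),
      (Z s (coeConfig U) e)ᴴ = -Z s (coeConfig U) e ∧ (Z s (coeConfig U) e).trace = 0)
    (hZid : ∀ (s : ℝ) (U : GaugeConfig d L (Matrix.specialUnitaryGroup (Fin n) ℂ)) (a : Edge d L) (ha : p a),
      fderiv ℝ (famb[σ(s)]) (coeConfig U) (Pi.single a (Z s (coeConfig U) a * (U a : Matrix (Fin n) (Fin n) ℂ))) a =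
        -(σ'(s) • (Qamb ⟨a, ha⟩ (coeConfig U) *
          (NormedSpace.exp (σ(s) • Qamb ⟨a, ha⟩ (coeConfig U)) * (U a : Matrix (Fin n) (Fin n) ℂ)))))
    (s : ℝ) (U : GaugeConfig d L (Matrix.specialUnitaryGroup (Fin n) ℂ)) {a : Edge d L} (ha : p a) :
    ∑ b, B.coord b (ContinuousLinearMap.inverse (Top[σ(s), coeConfig U, a])
      (suProj (σ'(s) • (fderiv ℝ (Qamb ⟨a, ha⟩) (coeConfig U) (Pi.single a (B.T b * (U a : Matrix (Fin n) (Fin n) ℂ)))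
          + (Qamb ⟨a, ha⟩ (coeConfig U) * (Blk[σ(s), coeConfig U, a]) (B.T b)
            - (Blk[σ(s), coeConfig U, a]) (B.T b) * Qamb ⟨a, ha⟩ (coeConfig U)))
        + fderiv ℝ (fun W' : AmbConfig d L n => (Blk[σ(s), W', a]) (B.T b)) (coeConfig U)
            (Pi.single a (Z s (coeConfig U) a * (U a : Matrix (Fin n) (Fin n) ℂ)))))) =
      -∑ b, B.coord b (fderiv ℝ (fun W : AmbConfig d L n => Z s W a) (coeConfig U)
        (Pi.single a (B.T b * (U a : Matrix (Fin n) (Fin n) ℂ)))) := by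
  have hσabs : |σ(s)| ≤ 1 := by
    have h1 := Real.cos_le_one (Real.pi * s)
    have h2 := Real.neg_one_le_cos (Real.pi * s)
    rw [abs_le]
    constructor <;> nlinarith
  have hT : IsUnit (Top[σ(s), coeConfig U, a]) :=
    isUnit_residualTangentOp p Q κ Qamb hQ2 hQ hlip hκ0 hκ hQambQ hσabs U ha
  set T := Top[σ(s), coeConfig U, a] with hTdef
  set Ti := ContinuousLinearMap.inverse T with hTidef
  set u : Matrix (Fin n) (Fin n) ℂ := (U a : Matrix (Fin n) (Fin n) ℂ) with hu
  set Qa := Qamb ⟨a, ha⟩ (coeConfig U) with hQa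
  set ζ := Z s (coeConfig U) a with hζ
  obtain ⟨hζ1, hζ2⟩ := hZsu s U a
  have hTb : ∀ b, (B.T b)ᴴ = -B.T b ∧ (B.T b).trace = 0 := fun b => (mem_suAlgebra_iff _).1 (B.mem b)
  have hQskew : Qaᴴ = -Qa ∧ Qa.trace = 0 := by
    rw [hQa, hQambQ]
    exact hQ ⟨a, ha⟩ (fun f => U f) _ (U a).2
  -- linearity helpers for `Ti` and `coord`
  have hTi_T : ∀ x, Ti (T x) = x := fun x => residualTangentOp_inverse_apply_left p Qamb (σ(s)) (coeConfig U) a hT x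
  have hTiP : ∀ y, Ti (suProj y) = suProj (Ti y) := fun y =>
    residualTangentOp_inverse_suProj_comm p Qamb (σ(s)) (coeConfig U) a hT y
  -- `Blk X = T X` on `𝔰𝔲(n)`
  have hBlkT : ∀ {X : Matrix (Fin n) (Fin n) ℂ}, Xᴴ = -X → X.trace = 0 →
      (Blk[σ(s), coeConfig U, a]) X = T X := fun hX hX0 =>
    (residualTangentOp_apply_of_skew p Q κ Qamb hQ2 hQ hlip hQambQ (σ(s)) U ha hX hX0).symm
  -- (♣) for each basis direction: `T (∂_b ζ) = -σ' DQ_b - 𝒫 D_b ζ`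
  have hlin : ∀ b, fderiv ℝ (fun W : AmbConfig d L n => Z s W a) (coeConfig U) (Pi.single a (B.T b * u)) =
      Ti (-(σ'(s) • fderiv ℝ (Qamb ⟨a, ha⟩) (coeConfig U) (Pi.single a (B.T b * u)))
        - suProj (fderiv ℝ (fun W' : AmbConfig d L n => (Blk[σ(s), W', a]) ζ) (coeConfig U)
            (Pi.single a (B.T b * u)))) := by
    intro b
    have h := residualTangentOp_apply_fderiv_generator p Q κ Qamb hQ2 hQ hlip hQambQ hZ1 hZsu hZid s U ha
      (hTb b).1 (hTb b).2
    rw [fderiv_residualTangentOp_apply_vec p Qamb hQ2, ← hζ, suProj_eq_self hζ1 hζ2] at h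
    rw [← hTi_T (fderiv ℝ (fun W : AmbConfig d L n => Z s W a) (coeConfig U) (Pi.single a (B.T b * u))), h]
  -- rewrite the right-hand side
  have hRHS : -∑ b, B.coord b (fderiv ℝ (fun W : AmbConfig d L n => Z s W a) (coeConfig U)
      (Pi.single a (B.T b * u))) =
      ∑ b, (σ'(s) * B.coord b (Ti (fderiv ℝ (Qamb ⟨a, ha⟩) (coeConfig U) (Pi.single a (B.T b * u))))
        + B.coord b (Ti (suProj (fderiv ℝ (fun W' : AmbConfig d L n => (Blk[σ(s), W', a]) ζ) (coeConfig U)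
            (Pi.single a (B.T b * u)))))) := by
    rw [← Finset.sum_neg_distrib]
    refine Finset.sum_congr rfl fun b _ => ?_
    rw [hlin b, map_sub, map_neg, map_smul, suBasis_coord_sub, suBasis_coord_neg, suBasis_coord_smul]
    ring
  rw [hRHS]
  -- split the left-hand side
  have hLHS : ∀ b, B.coord b (Ti (suProj (σ'(s) • (fderiv ℝ (Qamb ⟨a, ha⟩) (coeConfig U) (Pi.single a (B.T b * u))
          + (Qa * (Blk[σ(s), coeConfig U, a]) (B.T b) - (Blk[σ(s), coeConfig U, a]) (B.T b) * Qa))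
        + fderiv ℝ (fun W' : AmbConfig d L n => (Blk[σ(s), W', a]) (B.T b)) (coeConfig U)
            (Pi.single a (ζ * u))))) =
      σ'(s) * B.coord b (Ti (fderiv ℝ (Qamb ⟨a, ha⟩) (coeConfig U) (Pi.single a (B.T b * u))))
        + σ'(s) * B.coord b (Ti (suProj (Qa * T (B.T b) - T (B.T b) * Qa)))
        + B.coord b (Ti (suProj (fderiv ℝ (fun W' : AmbConfig d L n => (Blk[σ(s), W', a]) (B.T b)) (coeConfig U)
            (Pi.single a (ζ * u))))) := by
    intro b
    rw [hBlkT (hTb b).1 (hTb b).2, suProj_add, smul_add, suProj_add, suProj_smul, suProj_smul,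
      suProj_fderiv_exponent p Q Qamb hQ2 hQ hQambQ U ⟨a, ha⟩ a (hTb b).1 (hTb b).2,
      map_add, map_add, map_smul, map_smul, suBasis_coord_add, suBasis_coord_add, suBasis_coord_smul,
      suBasis_coord_smul]
  simp_rw [hLHS]
  rw [Finset.sum_add_distrib, Finset.sum_add_distrib, Finset.sum_add_distrib]
  -- (α) the `ad_Q` term vanishes
  have hα : ∑ b, σ'(s) * B.coord b (Ti (suProj (Qa * T (B.T b) - T (B.T b) * Qa))) = 0 := by
    rw [← Finset.mul_sum, sum_coord_inverse_suProj_commutator p Qamb B (σ(s)) (coeConfig U) a hT Qa, mul_zero]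
  rw [hα, add_zero]
  -- (I) exchange identity on the last term
  have hex : ∀ b, fderiv ℝ (fun W' : AmbConfig d L n => (Blk[σ(s), W', a]) (B.T b)) (coeConfig U)
      (Pi.single a (ζ * u)) =
      fderiv ℝ (fun W' : AmbConfig d L n => (Blk[σ(s), W', a]) ζ) (coeConfig U) (Pi.single a (B.T b * u))
        + ((Blk[σ(s), coeConfig U, a]) (B.T b * ζ - ζ * B.T b)
          - ((Blk[σ(s), coeConfig U, a]) (B.T b) * (Blk[σ(s), coeConfig U, a]) ζ
            - (Blk[σ(s), coeConfig U, a]) ζ * (Blk[σ(s), coeConfig U, a]) (B.T b))) := by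
    intro b
    have h := fderiv_residualTangentBlock_exchange p Q κ Qamb hQ2 hQ hlip hQambQ (σ(s)) U ha
      (hTb b).1 (hTb b).2 hζ1 hζ2
    rw [← hu] at h
    rw [← h]
    abel
  simp_rw [hex]
  -- (β) and (γ) vanish
  have hcomm : ∀ b, (B.T b * ζ - ζ * B.T b)ᴴ = -(B.T b * ζ - ζ * B.T b) ∧ (B.T b * ζ - ζ * B.T b).trace = 0 :=
    fun b => commutator_skew (hTb b).1 hζ1
  have hBζ : ((Blk[σ(s), coeConfig U, a]) ζ)ᴴ = -((Blk[σ(s), coeConfig U, a]) ζ) ∧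
      ((Blk[σ(s), coeConfig U, a]) ζ).trace = 0 :=
    residualTangentBlock_skew p Q κ Qamb hQ2 hQ hlip hQambQ (σ(s)) U ha hζ1 hζ2
  set Bζ := (Blk[σ(s), coeConfig U, a]) ζ with hBζdef
  have hβγ : ∀ b, B.coord b (Ti (suProj
      (fderiv ℝ (fun W' : AmbConfig d L n => (Blk[σ(s), W', a]) ζ) (coeConfig U) (Pi.single a (B.T b * u))
        + ((Blk[σ(s), coeConfig U, a]) (B.T b * ζ - ζ * B.T b)
          - ((Blk[σ(s), coeConfig U, a]) (B.T b) * Bζ - Bζ * (Blk[σ(s), coeConfig U, a]) (B.T b)))))) =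
      B.coord b (Ti (suProj (fderiv ℝ (fun W' : AmbConfig d L n => (Blk[σ(s), W', a]) ζ) (coeConfig U)
        (Pi.single a (B.T b * u)))))
      + B.coord b (B.T b * ζ - ζ * B.T b)
      + B.coord b (Ti (suProj (Bζ * T (B.T b) - T (B.T b) * Bζ))) := by
    intro b
    rw [hBlkT (hcomm b).1 (hcomm b).2, hBlkT (hTb b).1 (hTb b).2, suProj_add, suProj_sub, map_add, map_sub,
      suBasis_coord_add, suBasis_coord_sub, ← residualTangentOp_suProj_comm, suProj_eq_self (hcomm b).1 (hcomm b).2,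
      hTi_T]
    have hneg : T (B.T b) * Bζ - Bζ * T (B.T b) = -(Bζ * T (B.T b) - T (B.T b) * Bζ) := by abel
    rw [hneg, suProj_neg', map_neg, suBasis_coord_neg]
    ring
  simp_rw [hβγ]
  rw [Finset.sum_add_distrib, Finset.sum_add_distrib]
  have hβ : ∑ b, B.coord b (B.T b * ζ - ζ * B.T b) = 0 := by
    have h := sum_suBasis_coord_commutator B ζ
    rw [← neg_eq_zero, ← Finset.sum_neg_distrib] at h
    rw [← h]
    refine Finset.sum_congr rfl fun b _ => ?_
    rw [← suBasis_coord_neg, neg_sub]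
  have hγ : ∑ b, B.coord b (Ti (suProj (Bζ * T (B.T b) - T (B.T b) * Bζ))) = 0 :=
    sum_coord_inverse_suProj_commutator p Qamb B (σ(s)) (coeConfig U) a hT Bζ
  rw [hβ, hγ, add_zero, add_zero]

end StaticIdentity

end Summit.Ventures.LatticeQCDFlow.Exactness

end
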